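import Mathlib.Analysis.Normed.Group.Ultra
import Mathlib.Analysis.Normed.Module.Basic
import Mathlib.Topology.MetricSpace.HausdorffDistance
import HarnessLib

/-!
# Crux `H413` — K2-LIT E3 «EllipticInputs», U12-h engine L6 (generic half): Harish-Chandra's ultrametric finiteness inequalities
# (HC1999 Lemma 19.4, Cor. 19.5 and the torus case `V = ∅` of Lemma 19.3) as pure ultrametric linear algebra

Cell `hodgecm-mathlib`, Track B «K2-LIT», crux item `stmt-HodgeConjecture-24833` (h413), line `K2_E3_EllipticInputs`, socket U12-h `sig_K2E3CharLocConstNearRegular` (‹#9L›), the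
deep socket STAB below it (memo v3 `K2/K2E3-p09/g0/MEMO-U12h-L5L6-statements.v3.K2E3-p09-g0.md` §3, files (F1)–(F3)); seat K2E3-p09 (g0).
`--supports stmt-HodgeConjecture-24833 --as helper`.  THEOREMS ONLY — no `def`, no named fact, no instance, no notation, no `sorry`.  GENERIC: an ultrametric normed additive
group `𝔤` (Mathlib `IsUltrametricDist`), additive maps standing for `p_𝔮`, `Ad(γt) − 1`, `Ad(k) − 1`; for (F3) a normed space over a normed field and a closed cone.
HONEST LABEL: HC_CM is proved only modulo the 7 printed citations (2 remaining named inputs: hLiu418 = stmt-HodgeConjecture-24832, h413 = stmt-HodgeConjecture-24833) until rung 0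
closes; count-neutral engine (the orbit language of Howe's theory, memo L5, instantiates it).

THE MATHEMATICS [HarishChandra1999, §19 pp. 82–84].  `𝔤 = 𝔱 ⊕ 𝔮` (`p_𝔮`, `p_𝔱 = 1 − p_𝔮`), `T = Ad(γt) − 1` commutes with `p_𝔮` and EXPANDS on `𝔮`: `c|p_𝔮 X| ≤ |T p_𝔮 X|`;
`A = Ad(k) − 1` is `δ`-small (`k ∈ K_ν^{1/2}`, `δ = |½L_ν|`); the lattice `L_ν^*` has radius `ℓ`.  LEMMA 19.4: if `Ad(γt)X₀ − Ad(k)X₀ ∈ L_ν^*`, i.e. `T X₀ = A X₀ + λ` with `|λ| ≤ ℓ`,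
then `c|p_𝔮 X₀| ≤ |p_𝔮| max(δ|X₀|, ℓ)` (§1 `mul_norm_proj_le_of_eq_add`), and every orbit point `X = Ad(k′)X₀ + λ′` has `|X − X₀| ≤ max(δ|X₀|, ℓ)` (§1 `norm_sub_le_of_sub_eq_add`).
COR. 19.5: when these bounds are `< |X₀|`, ultrametricity forces `|X| = |X₀|` for all orbit points, `|p_𝔱 X₀| = |X₀|`, and `|p_𝔱 X₀ − X′|` small relative to `|X₀|` (§2).
LEMMA 19.3 with `V = ∅` (torus case: `𝔱` has no non-zero nilpotent): the nilpotent unit sphere `𝒩 ∩ S` is compact, `𝔱` closed, disjoint ⇒ at distance `ε > 0` (§3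
`exists_pos_forall_le_norm_sub`); hence an orbit containing a nilpotent `Y` of the same (large) norm as `X₀` with `|p_𝔱 X₀ − Y| < ε|X₀|` is IMPOSSIBLE after rescaling by a scalar of
norm `|X₀|` (§3 `false_of_cone_near_submodule`) — so contributing `K_ν`-types have BOUNDED orbits, i.e. are trivial on a deeper `K₀`: STAB.

* §1 `mul_norm_proj_le_of_eq_add`, `norm_sub_le_of_sub_eq_add`;  §2 `norm_eq_of_norm_sub_lt'`, `norm_sub_proj_eq_of_norm_proj_lt`, `norm_sub_le_max_three`;
* §3 `exists_pos_forall_le_norm_sub` (compact vs closed, disjoint), **`false_of_cone_near_submodule`** (the rescaling contradiction).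

## References
* [HarishChandra1999] Harish-Chandra (DeBacker–Sally), *Admissible Invariant Distributions on Reductive p-adic Groups*, ULECT 16 (1999): Lemma 19.3, Lemma 19.4, Cor. 19.5 (pp. 82–84).
-/

set_option autoImplicit false
-- the mandated namespace repeats `HodgeConjecture.HodgeConjecture`, as in every `Theorems/*.lean` of this sub-problem
set_option linter.dupNamespace false

noncomputable section

open Metric Set

namespace Summit.HodgeConjecture.HodgeConjecture.Cruxes.H413.K2E3UltrametricOrbitFiniteness

/-! ## §1 Lemma 19.4: the `𝔮`-component of a point whose `Ad(γt)`- and `Ad(k)`-images differ by a lattice vector is small -/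

section Lemma194

variable {𝔤 : Type*} [NormedAddCommGroup 𝔤] [IsUltrametricDist 𝔤]

/-- **HC1999 Lemma 19.4, first inequality** (generic).  `pq` («`p_𝔮`», operator-bounded by `C ≥ 0`), `T` («`Ad(γt) − 1`», commuting with `pq` and `c`-EXPANDING on the image of `pq`),
`A` («`Ad(k) − 1`», `δ`-small), `lam` a lattice vector (`‖lam‖ ≤ ℓ`).  If `T X₀ = A X₀ + lam` then `c‖pq X₀‖ ≤ C · max(δ‖X₀‖, ℓ)`. [cite: HarishChandra1999, Lemma 19.4 p. 82] -/
theorem mul_norm_proj_le_of_eq_add (pq T A : 𝔤 →+ 𝔤) (hcomm : ∀ X, pq (T X) = T (pq X)) {c C δ ℓ : ℝ} (hC : 0 ≤ C)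
    (hT : ∀ X, c * ‖pq X‖ ≤ ‖T (pq X)‖) (hpq : ∀ X, ‖pq X‖ ≤ C * ‖X‖) (hA : ∀ X, ‖A X‖ ≤ δ * ‖X‖)
    {X₀ lam : 𝔤} (hlam : ‖lam‖ ≤ ℓ) (h : T X₀ = A X₀ + lam) :
    c * ‖pq X₀‖ ≤ C * max (δ * ‖X₀‖) ℓ := by
  calc c * ‖pq X₀‖ ≤ ‖T (pq X₀)‖ := hT X₀
    _ = ‖pq (A X₀ + lam)‖ := by rw [← hcomm, h]
    _ ≤ C * ‖A X₀ + lam‖ := hpq _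
    _ ≤ C * max ‖A X₀‖ ‖lam‖ := mul_le_mul_of_nonneg_left (IsUltrametricDist.norm_add_le_max _ _) hC
    _ ≤ C * max (δ * ‖X₀‖) ℓ := mul_le_mul_of_nonneg_left (max_le_max (hA X₀) hlam) hC

/-- **HC1999 Lemma 19.4, second inequality** (generic): an orbit point `X = Ad(k′) X₀ + λ′`, i.e. `X − X₀ = A′ X₀ + lam′` with `A′` `δ`-small and `‖lam′‖ ≤ ℓ`, satisfies
`‖X − X₀‖ ≤ max(δ‖X₀‖, ℓ)`. [cite: HarishChandra1999, Lemma 19.4 p. 83] -/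
theorem norm_sub_le_of_sub_eq_add (A' : 𝔤 →+ 𝔤) {δ ℓ : ℝ} (hA' : ∀ X, ‖A' X‖ ≤ δ * ‖X‖) {X X₀ lam' : 𝔤} (hlam' : ‖lam'‖ ≤ ℓ)
    (h : X - X₀ = A' X₀ + lam') : ‖X - X₀‖ ≤ max (δ * ‖X₀‖) ℓ := by
  rw [h]
  exact (IsUltrametricDist.norm_add_le_max _ _).trans (max_le_max (hA' X₀) hlam')

end Lemma194

/-! ## §2 Cor. 19.5: norm rigidity along the orbit (ultrametric bookkeeping) -/

section Cor195

variable {𝔤 : Type*} [NormedAddCommGroup 𝔤] [IsUltrametricDist 𝔤]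

/-- Ultrametric rigidity: `‖X − X₀‖ < ‖X₀‖ ⇒ ‖X‖ = ‖X₀‖` (all points of the orbit have the norm of `X₀`, Cor. 19.5). [cite: HarishChandra1999, Cor. 19.5 p. 83] -/
theorem norm_eq_of_norm_sub_lt' {X X₀ : 𝔤} (h : ‖X - X₀‖ < ‖X₀‖) : ‖X‖ = ‖X₀‖ := by
  have hX : X = (X - X₀) + X₀ := (sub_add_cancel X X₀).symm
  rw [hX, IsUltrametricDist.norm_add_eq_max_of_norm_ne_norm h.ne, max_eq_right h.le]

/-- `‖p_𝔮 X₀‖ < ‖X₀‖ ⇒ ‖p_𝔱 X₀‖ = ‖X₀‖` with `p_𝔱 X₀ = X₀ − p_𝔮 X₀` (Cor. 19.5: the `𝔱`-component carries the full norm). [cite: HarishChandra1999, Cor. 19.5 p. 83] -/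
theorem norm_sub_proj_eq_of_norm_proj_lt {X₀ Q : 𝔤} (h : ‖Q‖ < ‖X₀‖) : ‖X₀ - Q‖ = ‖X₀‖ := by
  have : ‖X₀ - Q - X₀‖ < ‖X₀‖ := by rwa [sub_sub_cancel_left, norm_neg]
  exact norm_eq_of_norm_sub_lt' this

/-- The three-term estimate of Cor. 19.5: `‖(X₀ − Q) − X′‖ ≤ max(‖X₀ − X′‖, ‖Q‖)` (with `Q = p_𝔮 X₀`, so `X₀ − Q = p_𝔱 X₀`): the `𝔱`-component of `X₀` is as close to every orbit point
`X′` as `X₀` is, up to the small `𝔮`-component. [cite: HarishChandra1999, Cor. 19.5 p. 83] -/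
theorem norm_sub_le_max_three {X₀ Q X' : 𝔤} : ‖X₀ - Q - X'‖ ≤ max ‖X₀ - X'‖ ‖Q‖ := by
  have h : X₀ - Q - X' = (X₀ - X') + (-Q) := by abel
  rw [h]
  exact (IsUltrametricDist.norm_add_le_max _ _).trans (by rw [norm_neg])

end Cor195

/-! ## §3 Lemma 19.3 with `V = ∅`: a closed cone meeting a closed subspace only at `0` stays at positive distance from it on the unit sphere -/

section Lemma193

/-- **Compact vs closed, disjoint ⇒ uniformly separated** (generic metric space): `K` compact, `C` closed, `K ∩ C = ∅` ⇒ `∃ ε > 0, ∀ Y ∈ K, ∀ Z ∈ C, ε ≤ dist Y Z`.  (Used with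
`K = 𝒩 ∩ S` the nilpotent unit sphere and `C = 𝔱`.) [cite: HarishChandra1999, Lemma 19.3 p. 83] -/
theorem exists_pos_forall_le_dist {M : Type*} [MetricSpace M] {K C : Set M} (hK : IsCompact K) (hC : IsClosed C) (hKC : Disjoint K C) :
    ∃ ε : ℝ, 0 < ε ∧ ∀ Y ∈ K, ∀ Z ∈ C, ε ≤ dist Y Z := by
  by_cases hCne : C.Nonempty
  swap
  · refine ⟨1, one_pos, fun Y _ Z hZ => (hCne ⟨Z, hZ⟩).elim⟩
  by_cases hKne : K.Nonempty
  swap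
  · refine ⟨1, one_pos, fun Y hY => (hKne ⟨Y, hY⟩).elim⟩
  -- `Y ↦ infDist Y C` is continuous and positive on `K`, hence bounded below by a positive constant on the compact `K`
  obtain ⟨Y₀, hY₀K, hmin⟩ := hK.exists_isMinOn hKne (continuous_infDist_pt C).continuousOn
  have hpos : 0 < infDist Y₀ C := (hC.notMem_iff_infDist_pos hCne).1 (Set.disjoint_left.1 hKC hY₀K)
  refine ⟨infDist Y₀ C, hpos, fun Y hY Z hZ => ?_⟩
  exact (hmin hY).trans (infDist_le_dist_of_mem hZ)

variable {F : Type*} [NormedField F] {𝔤 : Type*} [NormedAddCommGroup 𝔤] [NormedSpace F 𝔤]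

/-- **THE RESCALING CONTRADICTION** (HC1999 Lemma 19.3, torus case `V = ∅`): `𝒩 ⊆ 𝔤` a cone (`a • 𝒩 ⊆ 𝒩`), `𝔱` a subspace, separated on the unit sphere: `ε ≤ ‖Y − Z‖` for `Y ∈ 𝒩`,
`‖Y‖ = 1`, `Z ∈ 𝔱`.  Then there are NO `Y ∈ 𝒩`, `Z ∈ 𝔱` with `‖Y‖ = ‖a‖ ≠ 0` (a scalar `a` realising the norm) and `‖Z − Y‖ < ε‖a‖` — applied with `Y` a nilpotent point of the
orbit `𝒪_d`, `Z = p_𝔱 X₀`, and `a ∈ F` with `|a| = |X₀| ≥ q^{2ν}`: contributing orbits cannot be large. [cite: HarishChandra1999, Lemma 19.3 pp. 83–84] -/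
theorem false_of_cone_near_submodule {𝒩 : Set 𝔤} (h𝒩 : ∀ (a : F) (Y : 𝔤), Y ∈ 𝒩 → a • Y ∈ 𝒩) (𝔱 : Submodule F 𝔤) {ε : ℝ}
    (hsep : ∀ Y ∈ 𝒩, ‖Y‖ = 1 → ∀ Z ∈ 𝔱, ε ≤ ‖Y - Z‖)
    {a : F} (ha : a ≠ 0) {Y Z : 𝔤} (hY : Y ∈ 𝒩) (hYa : ‖Y‖ = ‖a‖) (hZ : Z ∈ 𝔱) (hclose : ‖Z - Y‖ < ε * ‖a‖) : False := by
  have ha' : 0 < ‖a‖ := norm_pos_iff.2 ha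
  have h1 : ‖a⁻¹ • Y‖ = 1 := by rw [norm_smul, norm_inv, hYa, inv_mul_cancel₀ ha'.ne']
  have h2 : ε ≤ ‖a⁻¹ • Y - a⁻¹ • Z‖ := hsep _ (h𝒩 a⁻¹ Y hY) h1 _ (𝔱.smul_mem a⁻¹ hZ)
  rw [← smul_sub, norm_smul, norm_inv, ← norm_neg (Y - Z), neg_sub] at h2
  have h3 : ‖a‖⁻¹ * ‖Z - Y‖ < ε := by
    rw [inv_mul_lt_iff₀ ha']
    exact hclose.trans_eq (mul_comm _ _)
  exact absurd h2 (not_le.2 h3)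

end Lemma193

end Summit.HodgeConjecture.HodgeConjecture.Cruxes.H413.K2E3UltrametricOrbitFiniteness

end
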